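import Summits.MatrixMultiplication.MatrixMultiplication.Theorems.AbelianSTPPCensusShapeCertVQDefs

/-!
# Abelian STPP census — kernel evaluation of the vQ certificate checker `ShapeCertVQ` (B: orders 344–347)

Cell mm-stpp, rung F-M1; successor kernel item VQ-CERT (T_E beyond 337 under vQ := vP ∧ E3⁺) in support of the closed crux item
stmt-MatrixMultiplication-19191; seat mm-stpp-vp-p2 (gen 1); support file (no definitions).  `ShapeCertVQ.checkQ M = true` by
`decide +kernel` (no `native_decide`, standard axioms), ONE theorem per order so that every kernel evaluation starts with empty
caches; `Elab.async false` keeps the evaluations sequential (one kernel computation in memory at a time; precedent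
`…ShapeCertVPEvalA`).  Measured in the seat folder (Lean `#eval` of the same search / kernel wall): 344, 345, 346, 347 —
candidate visits `0.9–1.1·10⁴` per order, kernel ≈ `40–160 s` per order.  The range lemma
`checkQ_344_347` collects the file; soundness `ShapeCertVQ.checkQ_sound` (`…ShapeCertVQSearch`) and the bridge
`ShapeCertVQ.shapeExclusionVQ_of_checkQ` (`…ShapeCertVQFinal`) turn it into the vQ shape exclusion, assembled in the leaf file.
WHAT THIS IS NOT: a Boolean evaluation; no statement about STPP families or `ω` by itself.
-/

set_option linter.dupNamespace false -- `MatrixMultiplication.MatrixMultiplication` (summit = problem, D-0017)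
set_option autoImplicit false
set_option Elab.async false -- sequential kernel evaluations (memory high-water of one order at a time)

namespace Summit.MatrixMultiplication.MatrixMultiplication.Theorems.ShapeCertVQ

set_option maxHeartbeats 0 in
/-- vQ certificate check at order `344` (kernel evaluation) -/
theorem checkQ_344 : checkQ 344 = true := by
  decide +kernel

set_option maxHeartbeats 0 in
/-- vQ certificate check at order `345` (kernel evaluation) -/
theorem checkQ_345 : checkQ 345 = true := by
  decide +kernel

set_option maxHeartbeats 0 in
/-- vQ certificate check at order `346` (kernel evaluation) -/
theorem checkQ_346 : checkQ 346 = true := by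
  decide +kernel

set_option maxHeartbeats 0 in
/-- vQ certificate check at order `347` (kernel evaluation) -/
theorem checkQ_347 : checkQ 347 = true := by
  decide +kernel

/-- **the vQ certificate holds at every order `344 ≤ M ≤ 347`** -/
theorem checkQ_344_347 (M : ℕ) (h₁ : 344 ≤ M) (h₂ : M ≤ 347) : checkQ M = true := by
  interval_cases M
  · exact checkQ_344
  · exact checkQ_345
  · exact checkQ_346
  · exact checkQ_347

end Summit.MatrixMultiplication.MatrixMultiplication.Theorems.ShapeCertVQ
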